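import Summits.KontsevichZagierPeriods.KontsevichZagierPeriods.Theses.CompiledSubstitutions
import Literature.ModelTheory.ExponentialFields.SemialgebraicComponents

/-!
# Route CompiledSubstitutions — `TanHalfAngleSemialgebraic` (item stmt-KontsevichZagierPeriods-3386)

The genus-0 compilation lemma of the route (card U1): for every rational angle polyhedron
`A = {u ∈ (−π, π)ⁿ : Σᵢ aⱼᵢ uᵢ < bⱼ π ∀ j}` (`a ∈ ℤ^{m×n}`, `b ∈ ℚ^m`), its image under the
coordinatewise half-angle tangent `t = tan(u/2)` is a `ℚ`-semialgebraic subset of `ℝⁿ`.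

## Proof

Work in `t`-space: `u = 2 arctan t` inverts `t = tan(u/2)` on `(−π, π)ⁿ`, so the image of
`{u ∈ (−π,π)ⁿ | P u}` is `{t | P (2 arctan t)}` (`image_tanHalf_eq`), and it suffices (finite
intersection over `j`) to treat one inequality `Λ(t) := Σᵢ aᵢ · 2 arctan tᵢ < b π`, `b = p/q`.

* *Algebraic carrier.* By the half-angle identities `(1+t²) cos(2 arctan t) = 1 − t²`,
  `(1+t²) sin(2 arctan t) = 2t` and the addition formulas there is a polynomial
  `S ∈ ℚ[t₁, …, tₙ]` and a positive function `ρ` with `S(t) = ρ(t) sin(q Λ(t))`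
  (`exists_poly_sin_sum`); so `Z := {sin(q Λ) = 0} = {S = 0}` is `ℚ`-algebraic.
* *Level set.* `H := {Λ = bπ} ⊆ Z` is connected (image of a convex set) and the other level sets
  of `Λ` inside `Z` are at distance `≥ π/q` in value, so by the intermediate value theorem `H` is
  exactly a connected component of `Z` — hence `ℚ`-semialgebraic, connected components of
  `ℚ`-semialgebraic sets being `ℚ`-semialgebraic (tree:
  `IsSemialgebraic.isSemialgebraic_connectedComponentIn`, Basu–Pollack–Roy 2006, Thm. 5.22).
* *Sublevel set.* `{Λ < bπ}` is connected and, by the intermediate value theorem again, a connected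
  component of the `ℚ`-semialgebraic set `Hᶜ`.

References: M. Kontsevich, D. Zagier, *Periods* (2001), §1.2; S. Basu, R. Pollack, M.-F. Roy,
*Algorithms in Real Algebraic Geometry* (2006), Thm. 5.22; J. Bochnak, M. Coste, M.-F. Roy,
*Real Algebraic Geometry* (1998), §2.4.
-/

noncomputable section

namespace Summit.KontsevichZagierPeriods.CompiledSubstitutions.TanHalfAngleSemialgebraic

open Set MvPolynomial Real
open Literature.ModelTheory.ExponentialFields
open Summit.KontsevichZagierPeriods.KontsevichZagierPeriods.Theses.CompiledSubstitutions

variable {n : ℕ}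

/-! ### Half-angle identities -/

/-- `(1 + x²) cos(2 arctan x) = 1 − x²` (half-angle substitution). [folklore] -/
theorem one_add_sq_mul_cos_two_mul_arctan (x : ℝ) :
    (1 + x ^ 2) * Real.cos (2 * Real.arctan x) = 1 - x ^ 2 := by
  rw [Real.cos_two_mul, Real.cos_sq_arctan]
  have h : (1 + x ^ 2) ≠ 0 := by positivity
  field_simp
  ring

/-- `(1 + x²) sin(2 arctan x) = 2x` (half-angle substitution). [folklore] -/
theorem one_add_sq_mul_sin_two_mul_arctan (x : ℝ) :
    (1 + x ^ 2) * Real.sin (2 * Real.arctan x) = 2 * x := by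
  rw [Real.sin_two_mul]
  have hc : Real.cos (Real.arctan x) ≠ 0 := (Real.cos_arctan_pos x).ne'
  have hs : Real.sin (Real.arctan x) = x * Real.cos (Real.arctan x) := by
    have h := Real.tan_mul_cos hc
    rw [Real.tan_arctan] at h
    exact h.symm
  have h2 : Real.cos (Real.arctan x) ^ 2 = 1 / (1 + x ^ 2) := Real.cos_sq_arctan x
  have h : (1 + x ^ 2) ≠ 0 := by positivity
  rw [hs]
  calc (1 + x ^ 2) * (2 * (x * Real.cos (Real.arctan x)) * Real.cos (Real.arctan x))
      = 2 * x * ((1 + x ^ 2) * Real.cos (Real.arctan x) ^ 2) := by ring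
    _ = 2 * x := by rw [h2]; field_simp

/-! ### Polynomial representatives of `cos` / `sin` of integer angle combinations -/

/-- Addition step: polynomial representatives (up to a positive factor) of `cos θ₁, sin θ₁` and of
`cos θ₂, sin θ₂` give ones of `cos (θ₁ + θ₂), sin (θ₁ + θ₂)` (addition formulas). [folklore] -/
theorem exists_poly_cos_sin_add {θ₁ θ₂ : (Fin n → ℝ) → ℝ}
    (h₁ : ∃ C S : MvPolynomial (Fin n) ℚ, ∃ ρ : (Fin n → ℝ) → ℝ, (∀ t, 0 < ρ t) ∧
      ∀ t, aeval t C = ρ t * Real.cos (θ₁ t) ∧ aeval t S = ρ t * Real.sin (θ₁ t))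
    (h₂ : ∃ C S : MvPolynomial (Fin n) ℚ, ∃ ρ : (Fin n → ℝ) → ℝ, (∀ t, 0 < ρ t) ∧
      ∀ t, aeval t C = ρ t * Real.cos (θ₂ t) ∧ aeval t S = ρ t * Real.sin (θ₂ t)) :
    ∃ C S : MvPolynomial (Fin n) ℚ, ∃ ρ : (Fin n → ℝ) → ℝ, (∀ t, 0 < ρ t) ∧
      ∀ t, aeval t C = ρ t * Real.cos (θ₁ t + θ₂ t) ∧
        aeval t S = ρ t * Real.sin (θ₁ t + θ₂ t) := by
  obtain ⟨C₁, S₁, ρ₁, hρ₁, h₁⟩ := h₁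
  obtain ⟨C₂, S₂, ρ₂, hρ₂, h₂⟩ := h₂
  refine ⟨C₁ * C₂ - S₁ * S₂, S₁ * C₂ + C₁ * S₂, fun t => ρ₁ t * ρ₂ t,
    fun t => mul_pos (hρ₁ t) (hρ₂ t), fun t => ?_⟩
  obtain ⟨hc₁, hs₁⟩ := h₁ t
  obtain ⟨hc₂, hs₂⟩ := h₂ t
  simp only [map_sub, map_mul, map_add, hc₁, hs₁, hc₂, hs₂, Real.cos_add, Real.sin_add]
  constructor <;> ring

/-- Base step: `1 − tᵢ²` and `2 tᵢ` represent `cos (2 arctan tᵢ)` and `sin (2 arctan tᵢ)` up to the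
positive factor `1 + tᵢ²`. [folklore] -/
theorem exists_poly_cos_sin_base (i : Fin n) :
    ∃ C S : MvPolynomial (Fin n) ℚ, ∃ ρ : (Fin n → ℝ) → ℝ, (∀ t, 0 < ρ t) ∧
      ∀ t, aeval t C = ρ t * Real.cos (2 * Real.arctan (t i)) ∧
        aeval t S = ρ t * Real.sin (2 * Real.arctan (t i)) := by
  refine ⟨1 - X i ^ 2, 2 * X i, fun t => 1 + t i ^ 2, fun t => by positivity, fun t => ⟨?_, ?_⟩⟩
  · simp only [map_sub, map_one, map_pow, aeval_X]
    exact (one_add_sq_mul_cos_two_mul_arctan (t i)).symm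
  · simp only [map_mul, map_ofNat, aeval_X]
    exact (one_add_sq_mul_sin_two_mul_arctan (t i)).symm

/-- Natural multiples: representatives of `cos (k · 2 arctan tᵢ)`, `sin (k · 2 arctan tᵢ)`.
[folklore] -/
theorem exists_poly_cos_sin_nsmul (i : Fin n) (k : ℕ) :
    ∃ C S : MvPolynomial (Fin n) ℚ, ∃ ρ : (Fin n → ℝ) → ℝ, (∀ t, 0 < ρ t) ∧
      ∀ t, aeval t C = ρ t * Real.cos ((k : ℝ) * (2 * Real.arctan (t i))) ∧
        aeval t S = ρ t * Real.sin ((k : ℝ) * (2 * Real.arctan (t i))) := by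
  induction k with
  | zero => exact ⟨1, 0, fun _ => 1, fun _ => one_pos, fun t => by simp⟩
  | succ k ih =>
    have h := exists_poly_cos_sin_add ih (exists_poly_cos_sin_base i)
    simp only [Nat.cast_succ, add_mul, one_mul]
    exact h

/-- Integer multiples: representatives of `cos (k · 2 arctan tᵢ)`, `sin (k · 2 arctan tᵢ)`, `k ∈ ℤ`
(`cos` is even, `sin` is odd). [folklore] -/
theorem exists_poly_cos_sin_zsmul (i : Fin n) (k : ℤ) :
    ∃ C S : MvPolynomial (Fin n) ℚ, ∃ ρ : (Fin n → ℝ) → ℝ, (∀ t, 0 < ρ t) ∧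
      ∀ t, aeval t C = ρ t * Real.cos ((k : ℝ) * (2 * Real.arctan (t i))) ∧
        aeval t S = ρ t * Real.sin ((k : ℝ) * (2 * Real.arctan (t i))) := by
  obtain ⟨m, rfl | rfl⟩ := Int.eq_nat_or_neg k
  · simpa only [Int.cast_natCast] using exists_poly_cos_sin_nsmul i m
  · obtain ⟨C, S, ρ, hρ, h⟩ := exists_poly_cos_sin_nsmul i m
    refine ⟨C, -S, ρ, hρ, fun t => ?_⟩
    obtain ⟨hc, hs⟩ := h t
    constructor
    · rw [hc, Int.cast_neg, Int.cast_natCast, neg_mul, Real.cos_neg]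
    · rw [map_neg, hs, Int.cast_neg, Int.cast_natCast, neg_mul, Real.sin_neg, mul_neg]

/-- **Algebraic carrier.** For integer coefficients `e`, there is a polynomial `S ∈ ℚ[t₁,…,tₙ]`
and a positive function `ρ` with `S(t) = ρ(t) · sin (Σᵢ eᵢ · 2 arctan tᵢ)`: in the angles
`uᵢ = 2 arctan tᵢ` this is `e^{i Σ eᵢ uᵢ} = ∏ ((1 + i tᵢ)/(1 − i tᵢ))^{eᵢ}` taken apart.
[Kontsevich–Zagier 2001, §1.2; folklore] -/
theorem exists_poly_sin_sum (e : Fin n → ℤ) :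
    ∃ S : MvPolynomial (Fin n) ℚ, ∃ ρ : (Fin n → ℝ) → ℝ, (∀ t, 0 < ρ t) ∧
      ∀ t, aeval t S = ρ t * Real.sin (∑ i, (e i : ℝ) * (2 * Real.arctan (t i))) := by
  classical
  suffices key : ∀ s : Finset (Fin n), ∃ C S : MvPolynomial (Fin n) ℚ, ∃ ρ : (Fin n → ℝ) → ℝ,
      (∀ t, 0 < ρ t) ∧
      ∀ t, aeval t C = ρ t * Real.cos (∑ i ∈ s, (e i : ℝ) * (2 * Real.arctan (t i))) ∧
        aeval t S = ρ t * Real.sin (∑ i ∈ s, (e i : ℝ) * (2 * Real.arctan (t i))) by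
    obtain ⟨_C, S, ρ, hρ, hCS⟩ := key Finset.univ
    exact ⟨S, ρ, hρ, fun t => (hCS t).2⟩
  intro s
  induction s using Finset.induction_on with
  | empty => exact ⟨1, 0, fun _ => 1, fun _ => one_pos, fun t => by simp⟩
  | insert i s hi ih =>
    simp only [Finset.sum_insert hi]
    exact exists_poly_cos_sin_add (exists_poly_cos_sin_zsmul i (e i)) ih

/-! ### The half-angle tangent chart -/

/-- `u = 2 arctan t` inverts `t = tan(u/2)` on the open cube `(−π, π)ⁿ`: the image of
`{u ∈ (−π,π)ⁿ | P u}` under the coordinatewise half-angle tangent is `{t | P (2 arctan t)}`.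
[folklore] -/
theorem image_tanHalf_eq (P : (Fin n → ℝ) → Prop) :
    (fun u : Fin n → ℝ => fun i => Real.tan (u i / 2)) ''
        {u : Fin n → ℝ | (∀ i, u i ∈ Set.Ioo (-Real.pi) Real.pi) ∧ P u} =
      {t | P (fun i => 2 * Real.arctan (t i))} := by
  ext t
  constructor
  · rintro ⟨u, ⟨hu, hP⟩, rfl⟩
    have key : (fun i => 2 * Real.arctan (Real.tan (u i / 2))) = u := by
      funext i
      rw [Real.arctan_tan (by linarith [(hu i).1]) (by linarith [(hu i).2])]
      ring
    show P (fun i => 2 * Real.arctan (Real.tan (u i / 2)))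
    rw [key]
    exact hP
  · intro hP
    refine ⟨fun i => 2 * Real.arctan (t i), ⟨fun i => ⟨?_, ?_⟩, hP⟩, ?_⟩
    · linarith [Real.neg_pi_div_two_lt_arctan (t i)]
    · linarith [Real.arctan_lt_pi_div_two (t i)]
    · funext i
      have h2 : (2 : ℝ) * Real.arctan (t i) / 2 = Real.arctan (t i) := by ring
      simp only [h2, Real.tan_arctan]

/-- The coordinatewise half-angle tangent is continuous on the open cube `(−π, π)ⁿ`. [folklore] -/
theorem continuousOn_tanHalf :
    ContinuousOn (fun u : Fin n → ℝ => fun i => Real.tan (u i / 2))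
      {u | ∀ i, u i ∈ Set.Ioo (-Real.pi) Real.pi} := by
  refine continuousOn_pi.2 fun i => ?_
  refine Real.continuousOn_tan_Ioo.comp ((continuous_apply i).div_const 2).continuousOn
    fun u hu => ?_
  exact ⟨by linarith [(hu i).1], by linarith [(hu i).2]⟩

/-- The open cube `(−π, π)ⁿ` is convex. [folklore] -/
theorem convex_cube : Convex ℝ {u : Fin n → ℝ | ∀ i, u i ∈ Set.Ioo (-Real.pi) Real.pi} := by
  have h : {u : Fin n → ℝ | ∀ i, u i ∈ Set.Ioo (-Real.pi) Real.pi} =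
      Set.pi Set.univ (fun _ => Set.Ioo (-Real.pi) Real.pi) := by
    ext u; simp
  rw [h]
  exact convex_pi fun i _ => convex_Ioo _ _

/-- Images of convex pieces of the cube are preconnected: `{t | P (2 arctan t)}` is preconnected
whenever `{u | P u}` is convex. [folklore] -/
theorem isPreconnected_of_convex {P : (Fin n → ℝ) → Prop} (hP : Convex ℝ {u | P u}) :
    IsPreconnected {t : Fin n → ℝ | P (fun i => 2 * Real.arctan (t i))} := by
  rw [← image_tanHalf_eq P]
  refine IsPreconnected.image ?_ _ (continuousOn_tanHalf.mono fun u hu => hu.1)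
  rw [Set.setOf_and]
  exact (convex_cube.inter hP).isPreconnected

/-- The linear forms `u ↦ Σᵢ aᵢ uᵢ` are linear maps. [folklore] -/
theorem isLinearMap_sum (a : Fin n → ℤ) :
    IsLinearMap ℝ fun u : Fin n → ℝ => ∑ i, (a i : ℝ) * u i := by
  refine ⟨fun u v => ?_, fun c u => ?_⟩
  · simp only [Pi.add_apply, mul_add, Finset.sum_add_distrib]
  · simp only [Pi.smul_apply, smul_eq_mul, Finset.mul_sum]
    exact Finset.sum_congr rfl fun i _ => by ring

/-- `Λ(t) = Σᵢ aᵢ · 2 arctan tᵢ` is continuous. [folklore] -/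
theorem continuous_sum_arctan (a : Fin n → ℤ) :
    Continuous fun t : Fin n → ℝ => ∑ i, (a i : ℝ) * (2 * Real.arctan (t i)) :=
  continuous_finsetSum _ fun i _ =>
    continuous_const.mul (continuous_const.mul (Real.continuous_arctan.comp (continuous_apply i)))

/-! ### Separation of the level sets -/

/-- Between `pπ/q` and `Nπ/q` (`N ≠ p` integers, `q ≥ 1`) there is a value `v` with
`sin (q v) ≠ 0` (namely `(pπ ∓ π/2)/q`). [folklore] -/
theorem exists_mem_uIcc_sin_ne_zero {q : ℕ} (hq : 0 < q) {p N : ℤ} (hNp : N ≠ p) :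
    ∃ v ∈ Set.uIcc ((p : ℝ) * π / q) ((N : ℝ) * π / q), Real.sin (q * v) ≠ 0 := by
  have hq' : (0 : ℝ) < q := by exact_mod_cast hq
  have hcos : Real.cos (p * π) ≠ 0 := by
    intro h
    have h1 := Real.sin_sq_add_cos_sq ((p : ℝ) * π)
    rw [Real.sin_int_mul_pi, h] at h1
    norm_num at h1
  rcases lt_or_gt_of_ne hNp with hlt | hgt
  · have h1 : (N : ℝ) + 1 ≤ p := by
      have := Int.add_one_le_iff.2 hlt
      exact_mod_cast this
    refine ⟨((p : ℝ) * π - π / 2) / q, ?_, ?_⟩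
    · refine Set.Icc_subset_uIcc' ⟨?_, ?_⟩
      · apply div_le_div_of_nonneg_right _ hq'.le
        nlinarith [mul_le_mul_of_nonneg_right h1 Real.pi_pos.le, Real.pi_pos]
      · apply div_le_div_of_nonneg_right _ hq'.le
        linarith [Real.pi_pos]
    · have h2 : (q : ℝ) * (((p : ℝ) * π - π / 2) / q) = p * π - π / 2 := by field_simp
      rw [h2, Real.sin_sub, Real.sin_int_mul_pi, Real.cos_pi_div_two, Real.sin_pi_div_two]
      simpa using hcos
  · have h1 : (p : ℝ) + 1 ≤ N := by
      have := Int.add_one_le_iff.2 hgt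
      exact_mod_cast this
    refine ⟨((p : ℝ) * π + π / 2) / q, ?_, ?_⟩
    · refine Set.Icc_subset_uIcc ⟨?_, ?_⟩
      · apply div_le_div_of_nonneg_right _ hq'.le
        linarith [Real.pi_pos]
      · apply div_le_div_of_nonneg_right _ hq'.le
        nlinarith [mul_le_mul_of_nonneg_right h1 Real.pi_pos.le, Real.pi_pos]
    · have h2 : (q : ℝ) * (((p : ℝ) * π + π / 2) / q) = p * π + π / 2 := by field_simp
      rw [h2, Real.sin_add, Real.sin_int_mul_pi, Real.cos_pi_div_two, Real.sin_pi_div_two]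
      simpa using hcos

/-! ### Level and sublevel sets -/

/-- **Level sets are `ℚ`-semialgebraic.** For `a ∈ ℤⁿ`, `b ∈ ℚ`, the set
`{t | Σᵢ aᵢ · 2 arctan tᵢ = bπ}` — the `tan(u/2)`-image of a rational hyperplane section of the
cube — is a connected component of the `ℚ`-algebraic set `{sin (q Σᵢ aᵢ · 2 arctan tᵢ) = 0}`
(`b = p/q`), hence `ℚ`-semialgebraic. [Kontsevich–Zagier 2001, §1.2; Basu–Pollack–Roy 2006,
Thm. 5.22] -/
theorem isSemialgebraic_levelSet (a : Fin n → ℤ) (b : ℚ) :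
    IsSemialgebraic ℚ
      {t : Fin n → ℝ | ∑ i, (a i : ℝ) * (2 * Real.arctan (t i)) = (b : ℝ) * Real.pi} := by
  classical
  -- `b = p / q`
  set q : ℕ := b.den with hq
  set p : ℤ := b.num with hp
  have hq0 : 0 < q := b.den_pos
  have hq0' : (0 : ℝ) < q := by exact_mod_cast hq0
  have hbq : (b : ℝ) * q = p := by
    have h := Rat.mul_den_eq_num b
    have h' : ((b * b.den : ℚ) : ℝ) = ((b.num : ℚ) : ℝ) := by rw [h]
    push_cast at h'
    exact h'
  -- the continuous function `Λ`
  set Λ : (Fin n → ℝ) → ℝ := fun t => ∑ i, (a i : ℝ) * (2 * Real.arctan (t i)) with hΛ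
  have hΛc : Continuous Λ := continuous_sum_arctan a
  -- the algebraic carrier `Z = {sin (q Λ) = 0} = {S = 0}`
  obtain ⟨S, ρ, hρ, hS⟩ := exists_poly_sin_sum (fun i => (q : ℤ) * a i)
  have hS' : ∀ t, aeval t S = ρ t * Real.sin (q * Λ t) := by
    intro t
    rw [hS t]
    congr 2
    simp only [hΛ, Finset.mul_sum]
    refine Finset.sum_congr rfl fun i _ => ?_
    push_cast
    ring
  set Z : Set (Fin n → ℝ) := {t | aeval t S = 0} with hZ
  have hZsa : IsSemialgebraic ℚ Z := isSemialgebraic_setOf_eval_eq_zero S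
  have hmemZ : ∀ t, t ∈ Z ↔ Real.sin (q * Λ t) = 0 := fun t => by
    simp only [hZ, Set.mem_setOf_eq, hS' t, mul_eq_zero, (hρ t).ne', false_or]
  show IsSemialgebraic ℚ {t | Λ t = b * π}
  by_cases hH : ({t | Λ t = b * π} : Set (Fin n → ℝ)) = ∅
  · rw [hH]; exact isSemialgebraic_empty
  obtain ⟨t₀, ht₀⟩ := Set.nonempty_iff_ne_empty.2 hH
  have ht₀' : Λ t₀ = b * π := ht₀
  -- `H ⊆ Z`
  have hHZ : {t | Λ t = b * π} ⊆ Z := by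
    intro t ht
    have ht' : Λ t = b * π := ht
    rw [hmemZ]
    have h1 : (q : ℝ) * Λ t = (p : ℝ) * π := by rw [ht', ← hbq]; ring
    rw [h1]
    exact Real.sin_int_mul_pi p
  suffices heq : {t | Λ t = b * π} = connectedComponentIn Z t₀ by
    rw [heq]; exact hZsa.isSemialgebraic_connectedComponentIn t₀
  apply Set.Subset.antisymm
  · -- `H` is preconnected, contains `t₀`, lies in `Z`
    refine IsPreconnected.subset_connectedComponentIn ?_ ht₀ hHZ
    exact isPreconnected_of_convex (P := fun u => ∑ i, (a i : ℝ) * u i = b * π)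
      (convex_hyperplane (isLinearMap_sum a) _)
  · -- the component of `t₀` in `Z` stays in the level `Λ = bπ`
    intro t₂ ht₂
    by_contra hne
    have hne' : Λ t₂ ≠ b * π := hne
    have hK : IsPreconnected (connectedComponentIn Z t₀) := isPreconnected_connectedComponentIn
    have hZ₂ : Real.sin (q * Λ t₂) = 0 := (hmemZ t₂).1 (connectedComponentIn_subset _ _ ht₂)
    obtain ⟨N, hN⟩ := Real.sin_eq_zero_iff.1 hZ₂
    have hNp : N ≠ p := by
      rintro rfl
      apply hne'
      have h1 : (q : ℝ) * Λ t₂ = q * (b * π) := by rw [← hN, ← hbq]; ring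
      exact mul_left_cancel₀ hq0'.ne' h1
    obtain ⟨v, hv, hsin⟩ := exists_mem_uIcc_sin_ne_zero hq0 hNp
    have h₀ : Λ t₀ = (p : ℝ) * π / q := by
      rw [ht₀', eq_div_iff hq0'.ne', ← hbq]; ring
    have h₂ : Λ t₂ = (N : ℝ) * π / q := by
      rw [eq_div_iff hq0'.ne', hN]; ring
    have hsub : Set.uIcc (Λ t₀) (Λ t₂) ⊆ Λ '' connectedComponentIn Z t₀ :=
      (hK.image Λ hΛc.continuousOn).ordConnected.uIcc_subset
        (Set.mem_image_of_mem Λ (mem_connectedComponentIn (hHZ ht₀)))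
        (Set.mem_image_of_mem Λ ht₂)
    rw [h₀, h₂] at hsub
    obtain ⟨t₃, ht₃, ht₃v⟩ := hsub hv
    have hZ₃ : Real.sin (q * Λ t₃) = 0 := (hmemZ t₃).1 (connectedComponentIn_subset _ _ ht₃)
    rw [ht₃v] at hZ₃
    exact hsin hZ₃

/-- **Sublevel sets are `ℚ`-semialgebraic.** For `a ∈ ℤⁿ`, `b ∈ ℚ`, the set
`{t | Σᵢ aᵢ · 2 arctan tᵢ < bπ}` — the `tan(u/2)`-image of a rational half-space section of the
cube — is a connected component of the complement of the level set, hence `ℚ`-semialgebraic.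
[Kontsevich–Zagier 2001, §1.2; Basu–Pollack–Roy 2006, Thm. 5.22] -/
theorem isSemialgebraic_subLevelSet (a : Fin n → ℤ) (b : ℚ) :
    IsSemialgebraic ℚ
      {t : Fin n → ℝ | ∑ i, (a i : ℝ) * (2 * Real.arctan (t i)) < (b : ℝ) * Real.pi} := by
  set Λ : (Fin n → ℝ) → ℝ := fun t => ∑ i, (a i : ℝ) * (2 * Real.arctan (t i)) with hΛ
  have hΛc : Continuous Λ := continuous_sum_arctan a
  have hHsa : IsSemialgebraic ℚ {t | Λ t = b * π}ᶜ := (isSemialgebraic_levelSet a b).compl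
  show IsSemialgebraic ℚ {t | Λ t < b * π}
  by_cases hG : ({t | Λ t < b * π} : Set (Fin n → ℝ)) = ∅
  · rw [hG]; exact isSemialgebraic_empty
  obtain ⟨t₁, ht₁⟩ := Set.nonempty_iff_ne_empty.2 hG
  have ht₁' : Λ t₁ < b * π := ht₁
  suffices heq : {t | Λ t < b * π} = connectedComponentIn {t | Λ t = b * π}ᶜ t₁ by
    rw [heq]; exact hHsa.isSemialgebraic_connectedComponentIn t₁
  apply Set.Subset.antisymm
  · refine IsPreconnected.subset_connectedComponentIn ?_ ht₁ fun t ht => ne_of_lt ht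
    exact isPreconnected_of_convex (P := fun u => ∑ i, (a i : ℝ) * u i < b * π)
      (convex_halfSpace_lt (isLinearMap_sum a) _)
  · intro t₂ ht₂
    by_contra hge
    have hne : Λ t₂ ≠ b * π := connectedComponentIn_subset _ _ ht₂
    have hgt : (b : ℝ) * π < Λ t₂ := lt_of_le_of_ne (not_lt.1 hge) (Ne.symm hne)
    have ht₁c : t₁ ∈ connectedComponentIn {t | Λ t = b * π}ᶜ t₁ :=
      mem_connectedComponentIn (show t₁ ∈ {t | Λ t = ↑b * π}ᶜ from ne_of_lt ht₁')
    obtain ⟨t₃, ht₃, h₃⟩ := isPreconnected_connectedComponentIn.intermediate_value ht₁c ht₂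
      hΛc.continuousOn ⟨ht₁'.le, hgt.le⟩
    exact connectedComponentIn_subset _ _ ht₃ h₃

/-! ### The item -/

/-- **`TanHalfAngleSemialgebraic`** (item stmt-KontsevichZagierPeriods-3386 of route
CompiledSubstitutions): the image of a rational angle polyhedron
`{u ∈ (−π, π)ⁿ | Σᵢ aⱼᵢ uᵢ < bⱼ π ∀ j}` under `t = tan(u/2)` (coordinatewise) is `ℚ`-semialgebraic.
[Kontsevich–Zagier 2001, §1.2; Basu–Pollack–Roy 2006, Thm. 5.22] -/
theorem tanHalfAngleSemialgebraic_proof : TanHalfAngleSemialgebraic := by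
  unfold TanHalfAngleSemialgebraic
  intro n m a b
  rw [image_tanHalf_eq (fun u : Fin n → ℝ => ∀ j, ∑ i, (a j i : ℝ) * u i < (b j : ℝ) * Real.pi)]
  have h : {t : Fin n → ℝ | ∀ j, ∑ i, (a j i : ℝ) * (2 * Real.arctan (t i)) < (b j : ℝ) * Real.pi}
      = ⋂ j ∈ (Finset.univ : Finset (Fin m)),
          {t : Fin n → ℝ | ∑ i, (a j i : ℝ) * (2 * Real.arctan (t i)) < (b j : ℝ) * Real.pi} := by
    ext t; simp
  show IsSemialgebraic ℚ
    {t : Fin n → ℝ | ∀ j, ∑ i, (a j i : ℝ) * (2 * Real.arctan (t i)) < (b j : ℝ) * Real.pi}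
  rw [h]
  exact IsSemialgebraic.biInter _ _ fun j _ => isSemialgebraic_subLevelSet (a j) (b j)

end Summit.KontsevichZagierPeriods.CompiledSubstitutions.TanHalfAngleSemialgebraic
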